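import Literature.Probability.Percolation.KozmaNitzanHGluing
import Literature.Probability.Percolation.KozmaNitzanGoodQuadruple
import Literature.Probability.Percolation.ClusterDeletionBound
import Summits.CriticalPhenomena.PercolationContinuityZ3.Theses.PercNearOneGluingNoHeavy
import HarnessLib

/-!
# Hub transfer: reliability measured in `G − o` costs at most the factor `1 / P(o ↮ a)`

Helper file for the crux items `NoHeavyLowerTail` (stmt-CriticalPhenomena-4575) /
`NearOneGluing` (stmt-CriticalPhenomena-4574) of route `PercNearOneGluingNoHeavy`
(lemma factory #1, coupling / correlation-inequality technique).

**The observation.** For vertices `a, b` and a deleted vertex set `C` of any finite weighted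
graph, the two DECREASING events `{a ↮ b in Cᶜ}` (no open path from `a` to `b` avoiding `C`) and
`{a ↮ C}` jointly force `{a ↮ b}`; Harris' inequality for two decreasing events therefore gives

  `P_{G−C}(a ↮ b) · P_G(a ↮ C) ≤ P_G(a ↮ b)`,   in particular   `P_{G−o}(a ↮ b) ≤ P_G(a ↮ b) / P_G(o ↮ a)`.

So deleting the observer `o` inflates the unreliability of a relay–target pair by at most the
factor `1 / P(o ↮ a)`: either the relay `a` is `√δ`-glued to `o` (and then `P(o ↮ b) ≤ P(o ↮ a) +
P(a ↮ b) < √δ + δ` outright), or its reliability survives the deletion of `o` up to `δ ↦ √δ`.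

**Consequences recorded here.**
* `HubTransfer.conjecture3_of_hGluing` / `hGluing_iff_conjecture3`: the house weakening
  "Conjecture 3H" (`KozmaNitzan.HGluing`, relays reliable to the target in the reference graph
  `H = G − o` of Kozma–Nitzan's Question 9) is EQUIVALENT to Kozma–Nitzan's Conjecture 3
  (`KozmaNitzan2024_conjecture3`), with `δ_3(ε) = min(δ_H(ε), δ_H(ε)·ε/2, ε/2)`;
  `nearOneGluing_of_hGluing`: the same for the route item `NearOneGluing`.
* `HubTransfer.nearOneGluing_of_eventGluingH`: EVENT GLUING WITH THE `G − o` BUDGET —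
  `P(o ↔ A, o ↮ b) ≤ max_{a ∈ A} P_{G−o}(a ↮ b)` on every finite weighted graph — already implies
  `NearOneGluing`. (The lead's depth-two theorem, LEAD-GEN5 §4b, proves exactly this display for
  observers all of whose non-relay neighbours are pendant relay-stars; with this socket that class
  satisfies Conjecture 3 with `ε = 2δ + √δ`, uniformly in the number of stars and relays.)

No new definitions; pure proofs over the tree's `prodBernoulli`, `openConn`, `openConnIn`,
`restrW`, `KozmaNitzan.HGluing`.
-/

noncomputable section

namespace Summit.CriticalPhenomena.PercolationContinuityZ3.Theorems

open MeasureTheory Set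
open Literature.Probability.Percolation Literature.Probability.LatticeModels

namespace HubTransfer

variable {V : Type*}

/-- **Path splitting.** An open path from `a` to `b` either stays inside `Cᶜ` or visits a vertex of
`C`: `{a ↔ b} ⊆ {a ↔ b in Cᶜ} ∪ ⋃_{v ∈ C} {a ↔ v}` (read off the tree's cluster-deletion inclusion
`openConn_diff_openConnIn_compl_subset`, dropping the disjoint-occurrence information). -/
theorem openConn_subset_openConnIn_compl_union [DecidableEq V] (C : Set V) (a b : V) :
    (openConn a b : Set (BondConfig V)) ⊆ openConnIn Cᶜ a b ∪ ⋃ v ∈ C, openConn a v := by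
  intro ω hω
  by_cases h : ω ∈ openConnIn Cᶜ a b
  · exact Or.inl h
  · have h' := openConn_diff_openConnIn_compl_subset C a b ⟨hω, h⟩
    obtain ⟨v, hv, hω'⟩ := mem_iUnion₂.1 h'
    exact Or.inr (mem_iUnion₂.2 ⟨v, hv, (disjointOccurrence_subset_inter _ _ hω').1⟩)

/-- **The two decreasing events force disconnection**: `{a ↮ b in Cᶜ} ∩ {a ↮ C} ⊆ {a ↮ b}`. -/
theorem notConnIn_inter_notConn_subset [DecidableEq V] (C : Set V) (a b : V) :
    (openConnIn Cᶜ a b : Set (BondConfig V))ᶜ ∩ (⋃ v ∈ C, openConn a v)ᶜ ⊆ (openConn a b)ᶜ := by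
  rintro ω ⟨h1, h2⟩ hω
  rcases openConn_subset_openConnIn_compl_union C a b hω with h | h
  · exact h1 h
  · exact h2 h

/-- **Hub transfer, set form** (Harris for two decreasing events): on every finite weighted graph,
`P(a ↮ b in Cᶜ) · P(a ↮ C) ≤ P(a ↮ b)`. -/
theorem real_notConnIn_mul_notConn_le {n : ℕ} (w : Sym2 (Fin n) → unitInterval) (C : Set (Fin n))
    (a b : Fin n) :
    (prodBernoulli w).real (openConnIn Cᶜ a b)ᶜ * (prodBernoulli w).real (⋃ v ∈ C, openConn a v)ᶜ ≤
      (prodBernoulli w).real (openConn a b)ᶜ :=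
  calc (prodBernoulli w).real (openConnIn Cᶜ a b)ᶜ * (prodBernoulli w).real (⋃ v ∈ C, openConn a v)ᶜ
      ≤ (prodBernoulli w).real ((openConnIn Cᶜ a b)ᶜ ∩ (⋃ v ∈ C, openConn a v)ᶜ) :=
        prodBernoulli_harris_lower w (isUpperSet_openConnIn _ a b).compl
          (isUpperSet_iUnion₂ fun v _ => isUpperSet_openConn a v).compl
          MeasurableSet.of_discrete MeasurableSet.of_discrete
    _ ≤ (prodBernoulli w).real (openConn a b)ᶜ :=
        measureReal_mono (notConnIn_inter_notConn_subset C a b) (measure_ne_top _ _)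

/-- **Hub transfer, one deleted vertex**: `P(a ↮ b off o) · P(o ↮ a) ≤ P(a ↮ b)`. -/
theorem real_notConnOff_mul_notConn_le {n : ℕ} (w : Sym2 (Fin n) → unitInterval) (o a b : Fin n) :
    (prodBernoulli w).real (openConnIn ({o}ᶜ : Set (Fin n)) a b)ᶜ * (prodBernoulli w).real (openConn o a)ᶜ ≤
      (prodBernoulli w).real (openConn a b)ᶜ := by
  have h := real_notConnIn_mul_notConn_le w ({o} : Set (Fin n)) a b
  have e : (⋃ v ∈ ({o} : Set (Fin n)), openConn a v : Set (BondConfig (Fin n))) = openConn o a := by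
    rw [biUnion_singleton, openConn_comm]
  rwa [e] at h

/-- **Hub transfer in the reference graph `H = G − o`** (weights restricted off `o`,
`restrW {o}ᶜ w`): for a relay `a ≠ o` and any target `b`,
`P_H(a ↮ b) · P_G(o ↮ a) ≤ P_G(a ↮ b)`. -/
theorem restrW_real_notConn_mul_le {n : ℕ} (w : Sym2 (Fin n) → unitInterval) {o a : Fin n}
    (hao : a ≠ o) (b : Fin n) :
    (prodBernoulli (restrW ({o}ᶜ : Set (Fin n)) w)).real (openConn a b)ᶜ *
        (prodBernoulli w).real (openConn o a)ᶜ ≤ (prodBernoulli w).real (openConn a b)ᶜ := by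
  have e : (prodBernoulli (restrW ({o}ᶜ : Set (Fin n)) w)).real (openConn a b)ᶜ =
      (prodBernoulli w).real (openConnIn ({o}ᶜ : Set (Fin n)) a b)ᶜ := by
    rw [probReal_compl_eq_one_sub MeasurableSet.of_discrete,
      probReal_compl_eq_one_sub MeasurableSet.of_discrete, KNGoodAux.restrW_real_openConn w o hao b]
  rw [e]
  exact real_notConnOff_mul_notConn_le w o a b

/-- **Hub transfer, ratio form**: `P_H(a ↮ b) ≤ P_G(a ↮ b) / P_G(o ↮ a)` whenever `P_G(o ↮ a) > 0`
(`H = G − o`, `a ≠ o`). Deleting the observer inflates a relay's unreliability by at most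
`1 / P(o ↮ a)`. -/
theorem restrW_real_notConn_le_div {n : ℕ} (w : Sym2 (Fin n) → unitInterval) {o a : Fin n}
    (hao : a ≠ o) (b : Fin n) (hpos : 0 < (prodBernoulli w).real (openConn o a)ᶜ) :
    (prodBernoulli (restrW ({o}ᶜ : Set (Fin n)) w)).real (openConn a b)ᶜ ≤
      (prodBernoulli w).real (openConn a b)ᶜ / (prodBernoulli w).real (openConn o a)ᶜ :=
  (le_div_iff₀ hpos).2 (restrW_real_notConn_mul_le w hao b)

/-- **Gluing through a relay** (union bound): `P(o ↔ b) ≥ P(a ↔ b) − P(o ↮ a)`. -/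
theorem real_openConn_ge_sub {n : ℕ} (w : Sym2 (Fin n) → unitInterval) (o a b : Fin n) :
    (prodBernoulli w).real (openConn a b) - (prodBernoulli w).real (openConn o a)ᶜ ≤
      (prodBernoulli w).real (openConn o b) := by
  have hsub : (openConn a b : Set (BondConfig (Fin n))) ⊆ openConn o b ∪ (openConn o a)ᶜ := by
    intro ω hω
    by_cases h : ω ∈ openConn o a
    · exact Or.inl (SimpleGraph.Reachable.trans h hω)
    · exact Or.inr h
  have h1 : (prodBernoulli w).real (openConn a b) ≤
      (prodBernoulli w).real (openConn o b ∪ (openConn o a)ᶜ) :=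
    measureReal_mono hsub (measure_ne_top _ _)
  have h2 : (prodBernoulli w).real (openConn o b ∪ (openConn o a)ᶜ) ≤
      (prodBernoulli w).real (openConn o b) + (prodBernoulli w).real (openConn o a)ᶜ :=
    measureReal_union_le (μ := prodBernoulli w) _ _
  linarith

/-- **Conjecture 3H ⟹ Conjecture 3** (hence `⟺`, see `hGluing_iff_conjecture3`): the house
weakening of Kozma–Nitzan's Conjecture 3 in which every relay is assumed reliable to the target in
the reference graph `H = G − o` already implies Conjecture 3 itself, with
`δ_3 = min(δ_H, δ_H·ε/2, ε/2)`. Proof: a relay `a` with `P(o ↮ a) < ε/2` glues `o` to `b` directly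
(`real_openConn_ge_sub`); otherwise every relay keeps `P_H(a ↮ b) ≤ P_G(a ↮ b)/P(o ↮ a) < δ_H`
(`restrW_real_notConn_mul_le`) and H-gluing applies. -/
theorem conjecture3_of_hGluing (hH : ∀ ε : ℝ, 0 < ε → ∃ δ : ℝ, 0 < δ ∧ KozmaNitzan.HGluing ε δ) :
    KozmaNitzan2024_conjecture3 := by
  intro ε hε
  obtain ⟨δ₁, hδ₁, hHG⟩ := hH ε hε
  have hε2 : 0 < ε / 2 := by positivity
  refine ⟨min δ₁ (min (δ₁ * (ε / 2)) (ε / 2)), lt_min hδ₁ (lt_min (mul_pos hδ₁ hε2) hε2), ?_⟩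
  intro n w A o b hoA hab
  have hδ1 : min δ₁ (min (δ₁ * (ε / 2)) (ε / 2)) ≤ δ₁ := min_le_left _ _
  have hδ2 : min δ₁ (min (δ₁ * (ε / 2)) (ε / 2)) ≤ δ₁ * (ε / 2) :=
    (min_le_right _ _).trans (min_le_left _ _)
  have hδ3 : min δ₁ (min (δ₁ * (ε / 2)) (ε / 2)) ≤ ε / 2 := (min_le_right _ _).trans (min_le_right _ _)
  by_cases hglue : ∃ a ∈ A, (prodBernoulli w).real (openConn o a)ᶜ < ε / 2
  · -- a relay glued to `o`: `P(o ↔ b) ≥ P(a ↔ b) - P(o ↮ a) > 1 - δ - ε/2 ≥ 1 - ε`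
    obtain ⟨a, ha, hoa⟩ := hglue
    have h1 := real_openConn_ge_sub w o a b
    have h2 := hab a ha
    linarith
  · -- no glued relay: the reliabilities survive in `H = G − o`
    push Not at hglue
    refine hHG n w A o b (lt_of_le_of_lt (by linarith) hoA) fun a ha => ?_
    have hoa := hglue a ha
    have hao : a ≠ o := by
      rintro rfl
      have h0 : (prodBernoulli w).real (openConn a a : Set (BondConfig (Fin n)))ᶜ = 0 := by
        have : (openConn a a : Set (BondConfig (Fin n)))ᶜ = ∅ := by
          rw [compl_empty_iff]
          exact eq_univ_of_forall fun ω => SimpleGraph.Reachable.refl _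
        rw [this, measureReal_empty]
      linarith
    have hmul := restrW_real_notConn_mul_le w hao b
    have hab' : (prodBernoulli w).real (openConn a b)ᶜ < min δ₁ (min (δ₁ * (ε / 2)) (ε / 2)) := by
      rw [probReal_compl_eq_one_sub MeasurableSet.of_discrete]
      linarith [hab a ha]
    have hPH : (prodBernoulli (restrW ({o}ᶜ : Set (Fin n)) w)).real (openConn a b)ᶜ < δ₁ := by
      by_contra hge
      push Not at hge
      have : δ₁ * (ε / 2) ≤ (prodBernoulli (restrW ({o}ᶜ : Set (Fin n)) w)).real (openConn a b)ᶜ *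
          (prodBernoulli w).real (openConn o a)ᶜ :=
        mul_le_mul hge hoa hε2.le measureReal_nonneg
      linarith
    rw [probReal_compl_eq_one_sub MeasurableSet.of_discrete] at hPH
    linarith

/-- **Conjecture 3H ⟺ Conjecture 3.** (`⟸` is the tree's `KozmaNitzan.hGluing_of_conjecture3`.) -/
theorem hGluing_iff_conjecture3 :
    (∀ ε : ℝ, 0 < ε → ∃ δ : ℝ, 0 < δ ∧ KozmaNitzan.HGluing ε δ) ↔ KozmaNitzan2024_conjecture3 :=
  ⟨conjecture3_of_hGluing, fun h _ hε => KozmaNitzan.hGluing_of_conjecture3 h hε⟩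

/-- The route item `NearOneGluing` is verbatim Kozma–Nitzan's Conjecture 3. -/
theorem nearOneGluing_iff_conjecture3 :
    Theses.PercNearOneGluingNoHeavy.NearOneGluing ↔ KozmaNitzan2024_conjecture3 := Iff.rfl

/-- **H-gluing suffices for the route's crux `NearOneGluing`.** -/
theorem nearOneGluing_of_hGluing (hH : ∀ ε : ℝ, 0 < ε → ∃ δ : ℝ, 0 < δ ∧ KozmaNitzan.HGluing ε δ) :
    Theses.PercNearOneGluingNoHeavy.NearOneGluing :=
  nearOneGluing_iff_conjecture3.2 (conjecture3_of_hGluing hH)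

/-- **Event gluing with the `G − o` budget implies H-gluing** at `(ε, min(ε/2, 1/2))`: if on every
finite weighted graph some relay `a ∈ A` has `P(o ↔ A, o ↮ b) ≤ P_{G−o}(a ↮ b)`, then
`P(o ↮ b) ≤ P(o ↮ A) + P(o ↔ A, o ↮ b) < 2δ ≤ ε` under the H-hypotheses. -/
theorem hGluing_of_eventGluingH
    (hEG : ∀ (n : ℕ) (w : Sym2 (Fin n) → unitInterval) (A : Finset (Fin n)) (o b : Fin n), A.Nonempty →
      ∃ a ∈ A, (prodBernoulli w).real ((⋃ x ∈ A, openConn o x) ∩ (openConn o b)ᶜ) ≤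
        (prodBernoulli (restrW ({o}ᶜ : Set (Fin n)) w)).real (openConn a b)ᶜ)
    (ε : ℝ) : KozmaNitzan.HGluing ε (min (ε / 2) (1 / 2)) := by
  intro n w A o b hoA hab
  have hδε : min (ε / 2) (1 / 2 : ℝ) ≤ ε / 2 := min_le_left _ _
  have hδ1 : min (ε / 2) (1 / 2 : ℝ) ≤ 1 / 2 := min_le_right _ _
  -- `A` is nonempty, since `P(o ↔ ∅) = 0`
  have hA : A.Nonempty := by
    rw [Finset.nonempty_iff_ne_empty]
    rintro rfl
    simp only [Finset.notMem_empty, iUnion_of_empty, iUnion_empty, measureReal_empty] at hoA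
    linarith
  obtain ⟨a, ha, hle⟩ := hEG n w A o b hA
  have hHa := hab a ha
  -- `P(o ↔ b) ≥ P(o ↔ A) - P(o ↔ A, o ↮ b)`
  have hsub : (⋃ x ∈ A, openConn o x : Set (BondConfig (Fin n))) ⊆
      openConn o b ∪ ((⋃ x ∈ A, openConn o x) ∩ (openConn o b)ᶜ) := by
    intro ω hω
    by_cases h : ω ∈ openConn o b
    · exact Or.inl h
    · exact Or.inr ⟨hω, h⟩
  have h0 : (prodBernoulli w).real (⋃ x ∈ A, openConn o x) ≤
      (prodBernoulli w).real (openConn o b ∪ ((⋃ x ∈ A, openConn o x) ∩ (openConn o b)ᶜ)) :=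
    measureReal_mono hsub (measure_ne_top _ _)
  have h1 : (prodBernoulli w).real (openConn o b ∪ ((⋃ x ∈ A, openConn o x) ∩ (openConn o b)ᶜ)) ≤
      (prodBernoulli w).real (openConn o b) +
        (prodBernoulli w).real ((⋃ x ∈ A, openConn o x) ∩ (openConn o b)ᶜ) :=
    measureReal_union_le (μ := prodBernoulli w) _ _
  have h2 : (prodBernoulli (restrW ({o}ᶜ : Set (Fin n)) w)).real (openConn a b)ᶜ < min (ε / 2) (1 / 2) := by
    rw [probReal_compl_eq_one_sub MeasurableSet.of_discrete]
    linarith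
  linarith

/-- **Event gluing with the `G − o` budget suffices for `NearOneGluing`**: if on every finite
weighted graph `P(o ↔ A, o ↮ b) ≤ max_{a ∈ A} P_{G−o}(a ↮ b)` (stated as: some relay `a ∈ A`
dominates), then Kozma–Nitzan's Conjecture 3 holds (through `hGluing_of_eventGluingH` and the hub
transfer `conjecture3_of_hGluing`). The reference graph `G − o` in a sufficient event-gluing
inequality is therefore free for the route. -/
theorem nearOneGluing_of_eventGluingH
    (hEG : ∀ (n : ℕ) (w : Sym2 (Fin n) → unitInterval) (A : Finset (Fin n)) (o b : Fin n), A.Nonempty →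
      ∃ a ∈ A, (prodBernoulli w).real ((⋃ x ∈ A, openConn o x) ∩ (openConn o b)ᶜ) ≤
        (prodBernoulli (restrW ({o}ᶜ : Set (Fin n)) w)).real (openConn a b)ᶜ) :
    Theses.PercNearOneGluingNoHeavy.NearOneGluing :=
  nearOneGluing_of_hGluing fun ε hε =>
    ⟨_, lt_min (half_pos hε) (by norm_num), hGluing_of_eventGluingH hEG ε⟩

end HubTransfer

end Summit.CriticalPhenomena.PercolationContinuityZ3.Theorems

end
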